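import Summits.BirchSwinnertonDyer.BirchSwinnertonDyer.Theorems.PrintCFramBottomClassIndexLawFiveLeSelmerCountLevelZeroRegistry
import Literature.NumberTheory.EllipticCurves.Disegni2020.PAdicBSDRankOneMultiplicativeProofs
import HarnessLib

/-!
# Crux `PrintCFram.BottomClassIndexLawFiveLe` (stmt-BirchSwinnertonDyer-20372), line `eisenstein-resource-bdp-line`, registry v31:
# THE B1 PAIR SPLIT INTO PRINT AND CONTENT (director (390) VARIANT-N shape for the promoted items)

Cell `bsd-print-cfram`, width seat `bsd-line-cfram-p1-w5` g11; helper `--supports stmt-BirchSwinnertonDyer-20372`. THEOREMS ONLY; no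
definition, no named fact, no `sorry`. BSD is not proved by any of this; no summit statement is proved by this seat; no registered stub is
closed; the crux stays OPEN.

WHAT THIS FILE RECORDS (an audit finding, kernel-checked). Registry v31's two research stubs `stub_bsdp_of_level` (B1-level) and
`stub_bsdp_of_sha_levelZero` (B1-sha⁰) conclude Miller's `BSDp W p` — `rank = r_an ∧ Ш(W)(p) finite ∧ ∃ q ∈ ℚ, #Ш_an = q ∧ ord_p q =
ord_p #Ш(W)(p)` — from hypotheses that contain NO published input. As CLOSED statements they therefore entail, for the rank-one CM-ramified
members, (i) the finiteness of `Ш(W/ℚ)[p^∞]` and (ii) the rationality of `#Ш_an(W)`, which the tree holds only as the NAMED FACTS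
`rank_eq_analyticRank_of_analyticRank_le_one` (Gross–Zagier–Kolyvagin, the crux's own antecedent) and `GrossZagier1986_thm_I_7_3` (both inside
`stub_prints5`'s `ToricPublishedInputs`); no print-based proof can close them flag-free AS STATED. The theorems below separate the PRINT part from
the CONTENT part losslessly:

* **content forms** (pure `p`-part, no named fact inside): «… same binders …, `Ш(W/ℚ)` finite → ∀ q ∈ ℚ, #Ш_an(W) = q → ord_p q = ord_p #Ш(W)(p)»;
* `shaOrd_of_stubBsdpOfLevel`, `shaOrd_of_stubBsdpOfShaLevelZero` — registered stub ⟹ content form (unconditional);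
* `stubBsdpOfLevel_of_GZK_of_GZ73_of_shaOrd`, `stubBsdpOfShaLevelZero_of_GZK_of_GZ73_of_shaOrd` — GZK ∧ GZ I.(7.3) ∧ content form ⟹ registered
  stub (verbatim text of registry v31);
* `stubBsdpOfLevel_iff_shaOrd`, `stubBsdpOfShaLevelZero_iff_shaOrd` — the equivalences granted the two print facts.

So the promoted items may be filed in the content form with the print facts as conjuncts of the line's cite stub, and the registered texts are
recovered in the kernel. References: Miller 2011 Def. 1.1 (`BSDp`); Gross–Zagier 1986 Thm. I.(7.3); Kolyvagin 1990; crux workfile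
`Lines/eisenstein_resource_bdp_line.lean` (v31) §1; seat notes `Lines/eisenstein-resource-bdp-line-w5g11-audit.md`.
-/

set_option autoImplicit false
-- `…BirchSwinnertonDyer.BirchSwinnertonDyer.Theorems…` is the problem's mandated namespace (D-0017).
set_option linter.dupNamespace false

noncomputable section

open scoped Classical

namespace Summit.BirchSwinnertonDyer.BirchSwinnertonDyer.Theorems.PrintCFram.B1ContentSplit

open NumberField IsDedekindDomain Field WeierstrassCurve
open Literature.NumberTheory.EllipticCurves Literature.NumberTheory.EllipticCurves.Rank1Residual

/-! ## §1 B1-level -/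

/-- **B1-level ⟹ its content form** (unconditional): granted registry v31's `stub_bsdp_of_level` (verbatim, hypothesis `hL`), every rank-one
CM-ramified member (`p ≥ 5`) with a `p`-divisible generator, finite `Ш(W/ℚ)` and `#Ш_an(W) = q ∈ ℚ` has `ord_p q = ord_p #Ш(W/ℚ)(p)` — the last
clause of Miller's `BSD(E,p)`, the rational `q` being unique. [cite: Miller2011LMS, Def. 1.1 (arXiv:1010.2431 p. 3)] -/
theorem shaOrd_of_stubBsdpOfLevel
    (hL : ∀ (W : WeierstrassCurve ℚ) [W.IsElliptic] [W.IsGloballyMinimal] (p : ℕ) [Fact p.Prime],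
      W.HasCM → CMRamified W p → 5 ≤ p → W.analyticRank = 1 →
      ∀ P : W.toAffine.Point, ¬ IsOfFinAddOrder P →
        (∀ R : W.toAffine.Point, ∃ (k : ℤ) (T : W.toAffine.Point), IsOfFinAddOrder T ∧ R = k • P + T) →
        (∃ Q : (W.baseChange ℚ_[p]).toAffine.Point, p • Q = W.toPadicPoint p P) →
        BSDp W p) :
    ∀ (W : WeierstrassCurve ℚ) [W.IsElliptic] [W.IsGloballyMinimal] (p : ℕ) [Fact p.Prime],
      W.HasCM → CMRamified W p → 5 ≤ p → W.analyticRank = 1 →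
      ∀ P : W.toAffine.Point, ¬ IsOfFinAddOrder P →
        (∀ R : W.toAffine.Point, ∃ (k : ℤ) (T : W.toAffine.Point), IsOfFinAddOrder T ∧ R = k • P + T) →
        (∃ Q : (W.baseChange ℚ_[p]).toAffine.Point, p • Q = W.toPadicPoint p P) →
        Finite W.sha → ∀ q : ℚ, shaAn W = (q : ℂ) →
        padicValRat p q = padicValNat p (Nat.card (AddCommGroup.primaryComponent W.sha p)) := by
  intro W _ _ p _ hCM hram h5 hr P hP hgen hlev _ q hq
  obtain ⟨-, -, q', hq', hval⟩ := (bsdp_iff W p).mp (hL W p hCM hram h5 hr P hP hgen hlev)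
  have hqq : q' = q := by exact_mod_cast hq'.symm.trans hq
  rw [← hqq]
  exact hval

/-- **GZK ∧ Gross–Zagier I.(7.3) ∧ content form ⟹ B1-level** (registry v31's `stub_bsdp_of_level`, VERBATIM as conclusion). The two print facts
supply the three non-`p`-adic clauses of `BSDp W p` in analytic rank one: `rank = r_an` and `Ш(W/ℚ)` finite (GZK, `hGZK`), `#Ш_an(W) ∈ ℚ`
(`Disegni2020.exists_rat_shaAn_eq_of_analyticRank_eq_one`, from `hGZ` and `hGZK`); the content form supplies the valuation identity.
[cite: GrossZagier1986, Thm. I.(7.3) 2) (p. 231)] [cite: Kolyvagin1990] [cite: Miller2011LMS, Def. 1.1] -/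
theorem stubBsdpOfLevel_of_GZK_of_GZ73_of_shaOrd (hGZK : rank_eq_analyticRank_of_analyticRank_le_one)
    (hGZ : GrossZagier1986_thm_I_7_3)
    (h : ∀ (W : WeierstrassCurve ℚ) [W.IsElliptic] [W.IsGloballyMinimal] (p : ℕ) [Fact p.Prime],
      W.HasCM → CMRamified W p → 5 ≤ p → W.analyticRank = 1 →
      ∀ P : W.toAffine.Point, ¬ IsOfFinAddOrder P →
        (∀ R : W.toAffine.Point, ∃ (k : ℤ) (T : W.toAffine.Point), IsOfFinAddOrder T ∧ R = k • P + T) →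
        (∃ Q : (W.baseChange ℚ_[p]).toAffine.Point, p • Q = W.toPadicPoint p P) →
        Finite W.sha → ∀ q : ℚ, shaAn W = (q : ℂ) →
        padicValRat p q = padicValNat p (Nat.card (AddCommGroup.primaryComponent W.sha p))) :
    ∀ (W : WeierstrassCurve ℚ) [W.IsElliptic] [W.IsGloballyMinimal] (p : ℕ) [Fact p.Prime],
      W.HasCM → CMRamified W p → 5 ≤ p → W.analyticRank = 1 →
      ∀ P : W.toAffine.Point, ¬ IsOfFinAddOrder P →
        (∀ R : W.toAffine.Point, ∃ (k : ℤ) (T : W.toAffine.Point), IsOfFinAddOrder T ∧ R = k • P + T) →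
        (∃ Q : (W.baseChange ℚ_[p]).toAffine.Point, p • Q = W.toPadicPoint p P) →
        BSDp W p := by
  intro W _ _ p _ hCM hram h5 hr P hP hgen hlev
  obtain ⟨hrk, hfin⟩ := hGZK W hr.le
  obtain ⟨q, hq⟩ := Disegni2020.exists_rat_shaAn_eq_of_analyticRank_eq_one hGZ hGZK W hr
  haveI := hfin
  exact (bsdp_iff W p).mpr ⟨hrk, inferInstance, q, hq, h W p hCM hram h5 hr P hP hgen hlev hfin q hq⟩

/-- **Granted GZK and Gross–Zagier I.(7.3), B1-level ⟺ its content form.** [cite: Miller2011LMS, Def. 1.1] [cite: GrossZagier1986, Thm. I.(7.3)] -/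
theorem stubBsdpOfLevel_iff_shaOrd (hGZK : rank_eq_analyticRank_of_analyticRank_le_one)
    (hGZ : GrossZagier1986_thm_I_7_3) :
    (∀ (W : WeierstrassCurve ℚ) [W.IsElliptic] [W.IsGloballyMinimal] (p : ℕ) [Fact p.Prime],
      W.HasCM → CMRamified W p → 5 ≤ p → W.analyticRank = 1 →
      ∀ P : W.toAffine.Point, ¬ IsOfFinAddOrder P →
        (∀ R : W.toAffine.Point, ∃ (k : ℤ) (T : W.toAffine.Point), IsOfFinAddOrder T ∧ R = k • P + T) →
        (∃ Q : (W.baseChange ℚ_[p]).toAffine.Point, p • Q = W.toPadicPoint p P) →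
        BSDp W p) ↔
    (∀ (W : WeierstrassCurve ℚ) [W.IsElliptic] [W.IsGloballyMinimal] (p : ℕ) [Fact p.Prime],
      W.HasCM → CMRamified W p → 5 ≤ p → W.analyticRank = 1 →
      ∀ P : W.toAffine.Point, ¬ IsOfFinAddOrder P →
        (∀ R : W.toAffine.Point, ∃ (k : ℤ) (T : W.toAffine.Point), IsOfFinAddOrder T ∧ R = k • P + T) →
        (∃ Q : (W.baseChange ℚ_[p]).toAffine.Point, p • Q = W.toPadicPoint p P) →
        Finite W.sha → ∀ q : ℚ, shaAn W = (q : ℂ) →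
        padicValRat p q = padicValNat p (Nat.card (AddCommGroup.primaryComponent W.sha p))) :=
  ⟨fun hL => shaOrd_of_stubBsdpOfLevel hL, fun h => stubBsdpOfLevel_of_GZK_of_GZ73_of_shaOrd hGZK hGZ h⟩

/-! ## §2 B1-sha⁰ -/

/-- **B1-sha⁰ ⟹ its content form** (unconditional): granted registry v31's `stub_bsdp_of_sha_levelZero` (verbatim, hypothesis `hS`), every
rank-one CM-ramified member (`p ≥ 5`) whose generator has level `0`, with `Ш(W/ℚ)[p] ≠ 0`, finite `Ш(W/ℚ)` and `#Ш_an(W) = q ∈ ℚ` has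
`ord_p q = ord_p #Ш(W/ℚ)(p)`. [cite: Miller2011LMS, Def. 1.1 (arXiv:1010.2431 p. 3)] -/
theorem shaOrd_of_stubBsdpOfShaLevelZero
    (hS : ∀ (W : WeierstrassCurve ℚ) [W.IsElliptic] [W.IsGloballyMinimal] (p : ℕ) [Fact p.Prime],
      W.HasCM → CMRamified W p → 5 ≤ p → W.analyticRank = 1 →
      ∀ P : W.toAffine.Point, ¬ IsOfFinAddOrder P →
        (∀ R : W.toAffine.Point, ∃ (k : ℤ) (T : W.toAffine.Point), IsOfFinAddOrder T ∧ R = k • P + T) →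
        (∀ Q : (W.baseChange ℚ_[p]).toAffine.Point, p • Q ≠ W.toPadicPoint p P) →
        (∃ s ∈ W.sha, s ≠ 0 ∧ p • s = 0) → BSDp W p) :
    ∀ (W : WeierstrassCurve ℚ) [W.IsElliptic] [W.IsGloballyMinimal] (p : ℕ) [Fact p.Prime],
      W.HasCM → CMRamified W p → 5 ≤ p → W.analyticRank = 1 →
      ∀ P : W.toAffine.Point, ¬ IsOfFinAddOrder P →
        (∀ R : W.toAffine.Point, ∃ (k : ℤ) (T : W.toAffine.Point), IsOfFinAddOrder T ∧ R = k • P + T) →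
        (∀ Q : (W.baseChange ℚ_[p]).toAffine.Point, p • Q ≠ W.toPadicPoint p P) →
        (∃ s ∈ W.sha, s ≠ 0 ∧ p • s = 0) →
        Finite W.sha → ∀ q : ℚ, shaAn W = (q : ℂ) →
        padicValRat p q = padicValNat p (Nat.card (AddCommGroup.primaryComponent W.sha p)) := by
  intro W _ _ p _ hCM hram h5 hr P hP hgen hlev hsha _ q hq
  obtain ⟨-, -, q', hq', hval⟩ := (bsdp_iff W p).mp (hS W p hCM hram h5 hr P hP hgen hlev hsha)
  have hqq : q' = q := by exact_mod_cast hq'.symm.trans hq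
  rw [← hqq]
  exact hval

/-- **GZK ∧ Gross–Zagier I.(7.3) ∧ content form ⟹ B1-sha⁰** (registry v31's `stub_bsdp_of_sha_levelZero`, VERBATIM as conclusion).
[cite: GrossZagier1986, Thm. I.(7.3) 2) (p. 231)] [cite: Kolyvagin1990] [cite: Miller2011LMS, Def. 1.1] -/
theorem stubBsdpOfShaLevelZero_of_GZK_of_GZ73_of_shaOrd (hGZK : rank_eq_analyticRank_of_analyticRank_le_one)
    (hGZ : GrossZagier1986_thm_I_7_3)
    (h : ∀ (W : WeierstrassCurve ℚ) [W.IsElliptic] [W.IsGloballyMinimal] (p : ℕ) [Fact p.Prime],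
      W.HasCM → CMRamified W p → 5 ≤ p → W.analyticRank = 1 →
      ∀ P : W.toAffine.Point, ¬ IsOfFinAddOrder P →
        (∀ R : W.toAffine.Point, ∃ (k : ℤ) (T : W.toAffine.Point), IsOfFinAddOrder T ∧ R = k • P + T) →
        (∀ Q : (W.baseChange ℚ_[p]).toAffine.Point, p • Q ≠ W.toPadicPoint p P) →
        (∃ s ∈ W.sha, s ≠ 0 ∧ p • s = 0) →
        Finite W.sha → ∀ q : ℚ, shaAn W = (q : ℂ) →
        padicValRat p q = padicValNat p (Nat.card (AddCommGroup.primaryComponent W.sha p))) :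
    ∀ (W : WeierstrassCurve ℚ) [W.IsElliptic] [W.IsGloballyMinimal] (p : ℕ) [Fact p.Prime],
      W.HasCM → CMRamified W p → 5 ≤ p → W.analyticRank = 1 →
      ∀ P : W.toAffine.Point, ¬ IsOfFinAddOrder P →
        (∀ R : W.toAffine.Point, ∃ (k : ℤ) (T : W.toAffine.Point), IsOfFinAddOrder T ∧ R = k • P + T) →
        (∀ Q : (W.baseChange ℚ_[p]).toAffine.Point, p • Q ≠ W.toPadicPoint p P) →
        (∃ s ∈ W.sha, s ≠ 0 ∧ p • s = 0) → BSDp W p := by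
  intro W _ _ p _ hCM hram h5 hr P hP hgen hlev hsha
  obtain ⟨hrk, hfin⟩ := hGZK W hr.le
  obtain ⟨q, hq⟩ := Disegni2020.exists_rat_shaAn_eq_of_analyticRank_eq_one hGZ hGZK W hr
  haveI := hfin
  exact (bsdp_iff W p).mpr ⟨hrk, inferInstance, q, hq, h W p hCM hram h5 hr P hP hgen hlev hsha hfin q hq⟩

/-- **Granted GZK and Gross–Zagier I.(7.3), B1-sha⁰ ⟺ its content form.** [cite: Miller2011LMS, Def. 1.1] [cite: GrossZagier1986, Thm. I.(7.3)] -/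
theorem stubBsdpOfShaLevelZero_iff_shaOrd (hGZK : rank_eq_analyticRank_of_analyticRank_le_one)
    (hGZ : GrossZagier1986_thm_I_7_3) :
    (∀ (W : WeierstrassCurve ℚ) [W.IsElliptic] [W.IsGloballyMinimal] (p : ℕ) [Fact p.Prime],
      W.HasCM → CMRamified W p → 5 ≤ p → W.analyticRank = 1 →
      ∀ P : W.toAffine.Point, ¬ IsOfFinAddOrder P →
        (∀ R : W.toAffine.Point, ∃ (k : ℤ) (T : W.toAffine.Point), IsOfFinAddOrder T ∧ R = k • P + T) →
        (∀ Q : (W.baseChange ℚ_[p]).toAffine.Point, p • Q ≠ W.toPadicPoint p P) →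
        (∃ s ∈ W.sha, s ≠ 0 ∧ p • s = 0) → BSDp W p) ↔
    (∀ (W : WeierstrassCurve ℚ) [W.IsElliptic] [W.IsGloballyMinimal] (p : ℕ) [Fact p.Prime],
      W.HasCM → CMRamified W p → 5 ≤ p → W.analyticRank = 1 →
      ∀ P : W.toAffine.Point, ¬ IsOfFinAddOrder P →
        (∀ R : W.toAffine.Point, ∃ (k : ℤ) (T : W.toAffine.Point), IsOfFinAddOrder T ∧ R = k • P + T) →
        (∀ Q : (W.baseChange ℚ_[p]).toAffine.Point, p • Q ≠ W.toPadicPoint p P) →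
        (∃ s ∈ W.sha, s ≠ 0 ∧ p • s = 0) →
        Finite W.sha → ∀ q : ℚ, shaAn W = (q : ℂ) →
        padicValRat p q = padicValNat p (Nat.card (AddCommGroup.primaryComponent W.sha p))) :=
  ⟨fun hS => shaOrd_of_stubBsdpOfShaLevelZero hS, fun h => stubBsdpOfShaLevelZero_of_GZK_of_GZ73_of_shaOrd hGZK hGZ h⟩

end Summit.BirchSwinnertonDyer.BirchSwinnertonDyer.Theorems.PrintCFram.B1ContentSplit

end
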